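import Summits.ResolutionOfSingularities.ResolutionOfSingularities.Theorems.MatroidCellRes.Negative.NonReducedGammaScheme
import Summits.ResolutionOfSingularities.ResolutionOfSingularities.Theorems.MatroidCellRes.Negative.IsIntegralLoadBearing
import Literature.AlgebraicGeometry.Resolution.RegularLocalRingsProofs
import Literature.Barriers.ResolutionOfSingularities.InseparableBaseChangeResolution
import HarnessLib

/-!
# `MatroidCellRes`, line `birth` — charts of the six-column example presented by five relations
# and a unit (algebra for `SaturatedChartIntegralityLoadBearing`)

Support (negative) lemma material for crux stmt-ResolutionOfSingularities-15230
(`Summit.ResolutionOfSingularities.ResolutionOfSingularities.Theses.UniversalCells.MatroidCellRes`,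
route UniversalCells, rank 2), filed by the crux disprover (cdisprove seat, generation 2). The
conclusions about the stubs of line `birth` — (N) `stub_saturatedEngineNonintegral` is false
without `hdom`, Hu's claim (H) is false without `IsDomain` — are drawn in
`Negative/SaturatedChartIntegralityLoadBearing.lean`; the dimension count is in
`Negative/ChartPresentationDimension.lean`. This file declares no definition and no notation.

## Content

Generation 1's Γ-scheme (`Negative/NonReducedGammaScheme.lean`): `m = 3`,
`Γ₀ = {(c₀,c₁,c₂), (e₂,c₀,c₂), (e₁,e₂,c₂), (e₀,e₂,c₀), (e₀,e₁,c₁)}`, minors `det A`,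
`a₀₀a₁₂ - a₀₂a₁₀`, `a₀₂`, `-a₁₀`, `a₂₁`; on `D(g₀)`, `g₀ = a₀₁a₂₀a₁₁a₂₂`, it is
`Spec 𝔽_p[y^±,u^±,z^±,v^±][x]/(x²)`. A **chart presentation** is a ring map `ι : 𝔽_p[A] → T`
killing the five minors, making `g₀` a unit, and universal with these two properties (`hlift`,
`hext`); the unsaturated chart `(Q_{Γ₀})_{g₀}` and its SATURATION `(Q_Γ)_g` (as produced by the
line's glue stub (B)) both are. For any chart presentation:

* §1 (general) a ring `T ≠ 0` with a nilpotent `f` whose annihilator lies in every prime is not a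
  regular ring (`not_isRegularRing_of_nilpotent_of_key`: `f ≠ 0` in the regular, hence integral,
  local ring at a maximal ideal — Matsumura 14.3 in tree, `isDomain_of_isRegularLocalRing`) and
  `Spec T` has no resolution (`not_hasResolution_of_nilpotent_of_key`: nowhere reduced, while a
  resolution is an isomorphism over a dense reduced open — `nowhereReduced_basicOpen`,
  `exists_dense_isReduced_of_hasResolution`);
* §2 `f = ι(a₀₁a₁₂a₂₀)` is nilpotent (`isNilpotent_ywu_of_relations`), `T ≠ 0`
  (`nontrivial_of_lift`, the `𝔽_p`-point `a₀₁ = a₂₀ = a₁₁ = a₂₂ = 1`), and the annihilator of `f`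
  lies in EVERY prime `𝔮` (`mem_of_mul_ywu_eq_zero`): generation 1's tangent vector, now valued in
  `Frac(T ⧸ 𝔮)[ε]` so that `g₀ ↦` a unit — `a₀₀ ↦ ȳū ε`, `a₁₂ ↦ -z̄v̄ ε`,
  `a₀₁, a₁₁, a₂₀, a₂₂ ↦ ȳ, z̄, ū, v̄`, other entries `↦ 0` — factors through `T` over the reduction
  `T → Frac(T ⧸ 𝔮)`, and the `ε`-coefficient of `τ(s) τ(f) = 0` reads `s̄ · (-ȳz̄v̄ū) = 0`.

Folklore throughout (explicit computation).
-/

noncomputable section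

-- single-problem summit: the doubled namespace component `ResolutionOfSingularities` is forced
set_option linter.dupNamespace false

open CategoryTheory AlgebraicGeometry TopologicalSpace Literature.AlgebraicGeometry.Resolution
open Literature.Barriers.ResolutionOfSingularities (exists_dense_isReduced_of_hasResolution)
open MvPolynomial (X C)

namespace Summit.ResolutionOfSingularities.ResolutionOfSingularities.Theorems.MatroidCellRes.Negative

/-! ## §1 Two general lemmas: a nilpotent whose annihilator lies in every prime -/

/-- If a commutative ring `T ≠ 0` carries a nilpotent `f` whose annihilator lies in every prime
ideal, then `T` is not a regular ring: `f` is a NON-ZERO nilpotent of the localisation at any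
maximal ideal, which would be a regular local ring, hence a domain (Matsumura 14.3, in tree:
`isDomain_of_isRegularLocalRing`). [folklore] -/
theorem not_isRegularRing_of_nilpotent_of_key {T : Type} [CommRing T] [Nontrivial T] (f : T)
    (hf : IsNilpotent f)
    (hkey : ∀ q : PrimeSpectrum T, ∀ s : T, s * f = 0 → s ∈ q.asIdeal) :
    ¬ IsRegularRing T := by
  intro hreg
  obtain ⟨m, hm⟩ := Ideal.exists_maximal T
  haveI : IsRegularLocalRing (Localization.AtPrime m) := inferInstance
  haveI : IsDomain (Localization.AtPrime m) :=
    isDomain_of_isRegularLocalRing (Localization.AtPrime m)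
  have h0 : algebraMap T (Localization.AtPrime m) f = 0 := (hf.map _).eq_zero
  obtain ⟨⟨s, hs⟩, hsf⟩ :=
    (IsLocalization.map_eq_zero_iff m.primeCompl (Localization.AtPrime m) f).mp h0
  exact hs (hkey ⟨m, hm.isPrime⟩ s hsf)

/-- If a commutative ring `T ≠ 0` carries a nilpotent `f` whose annihilator lies in every prime
ideal, then `Spec T` has NO resolution of singularities: `Spec T` is nowhere reduced
(`nowhereReduced_basicOpen` with `g = 1`), while a resolution is an isomorphism over a dense — hence
non-empty and reduced — open (`exists_dense_isReduced_of_hasResolution`). [folklore] -/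
theorem not_hasResolution_of_nilpotent_of_key {T : Type} [CommRing T] [Nontrivial T] (f : T)
    (hf : IsNilpotent f)
    (hkey : ∀ q : PrimeSpectrum T, ∀ s : T, s * f = 0 → s ∈ q.asIdeal) :
    ¬ Scheme.HasResolution (Spec (.of T)) := by
  intro hres
  obtain ⟨U, hUd, hUred⟩ := exists_dense_isReduced_of_hasResolution hres
  have hV := nowhereReduced_basicOpen f 1 hf (fun q _ s hs => hkey q s hs)
  obtain ⟨m, hm⟩ := Ideal.exists_maximal T
  haveI : Nonempty (Spec (.of T)) := ⟨(⟨m, hm.isPrime⟩ : PrimeSpectrum T)⟩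
  obtain ⟨u, hu⟩ := hUd.nonempty
  refine hV U ?_ ⟨u, hu⟩ hUred
  rw [PrimeSpectrum.basicOpen_one]
  exact le_top

/-! ## §2 Charts of the six-column example presented by the five relations and a unit

A "chart presentation" is a ring map `ι : 𝔽_p[A] → T` (with `A = (a_ij)`, `3 × 3`) that kills the
five minors `det A`, `a₀₀a₁₂ - a₀₂a₁₀`, `a₀₂`, `a₁₀`, `a₂₁` of `Γ₀`, makes `g₀ = a₀₁a₂₀a₁₁a₂₂` a
unit, and is universal with these properties (`hlift`, `hext`). Both the chart `(Q_{Γ₀})_{g₀}` and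
its saturation `(Q_Γ)_g` are such (§3). -/

section Chart

variable {p : ℕ} [Fact p.Prime] {T : Type} [CommRing T]
  (ι : MvPolynomial (Fin 3 × Fin 3) (ZMod p) →+* T)

/-- In a chart presentation `f = ι(a₀₁a₁₂a₂₀)` is nilpotent (`f² = 0`, `ywu_sq_eq_zero`).
[folklore] -/
theorem isNilpotent_ywu_of_relations
    (h1 : ι (X (0,0) * X (1,1) * X (2,2) - X (0,0) * X (1,2) * X (2,1)
        - X (0,1) * X (1,0) * X (2,2) + X (0,1) * X (1,2) * X (2,0)
        + X (0,2) * X (1,0) * X (2,1) - X (0,2) * X (1,1) * X (2,0)) = 0)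
    (h2 : ι (X (0,0) * X (1,2) - X (0,2) * X (1,0)) = 0)
    (h3 : ι (X (0,2)) = 0) (h4 : ι (X (1,0)) = 0) (h5 : ι (X (2,1)) = 0) :
    IsNilpotent (ι (X (0,1) * X (1,2) * X (2,0))) := by
  have r1 : ι (X (0,0)) * ι (X (1,1)) * ι (X (2,2)) - ι (X (0,0)) * ι (X (1,2)) * ι (X (2,1))
      - ι (X (0,1)) * ι (X (1,0)) * ι (X (2,2)) + ι (X (0,1)) * ι (X (1,2)) * ι (X (2,0))
      + ι (X (0,2)) * ι (X (1,0)) * ι (X (2,1)) - ι (X (0,2)) * ι (X (1,1)) * ι (X (2,0)) = 0 := by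
    simpa only [map_sub, map_add, map_mul] using h1
  have r2 : ι (X (0,0)) * ι (X (1,2)) - ι (X (0,2)) * ι (X (1,0)) = 0 := by
    simpa only [map_sub, map_mul] using h2
  refine ⟨2, ?_⟩
  rw [map_mul, map_mul]
  exact ywu_sq_eq_zero _ _ _ _ _ _ _ _ _ r1 r2 h3 h4 h5

/-- A chart presentation has a point: the `𝔽_p`-point `a₀₁ = a₂₀ = a₁₁ = a₂₂ = 1`, all other entries
`0`, satisfies the five relations and makes `g₀` a unit; so `T ≠ 0`. [folklore] -/
theorem nontrivial_of_lift
    (hlift : ∀ (D : Type) [CommRing D] (ψ : MvPolynomial (Fin 3 × Fin 3) (ZMod p) →+* D),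
      ψ (X (0,0) * X (1,1) * X (2,2) - X (0,0) * X (1,2) * X (2,1)
        - X (0,1) * X (1,0) * X (2,2) + X (0,1) * X (1,2) * X (2,0)
        + X (0,2) * X (1,0) * X (2,1) - X (0,2) * X (1,1) * X (2,0)) = 0 →
      ψ (X (0,0) * X (1,2) - X (0,2) * X (1,0)) = 0 →
      ψ (X (0,2)) = 0 → ψ (X (1,0)) = 0 → ψ (X (2,1)) = 0 →
      IsUnit (ψ (X (0,1) * X (2,0) * X (1,1) * X (2,2))) →
      ∃ φ : T →+* D, ∀ a, φ (ι a) = ψ a) :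
    Nontrivial T := by
  obtain ⟨φ, -⟩ := hlift (ZMod p)
    (MvPolynomial.eval fun ij : Fin 3 × Fin 3 =>
      if ij = (0,1) ∨ ij = (2,0) ∨ ij = (1,1) ∨ ij = (2,2) then (1 : ZMod p) else 0)
    (by simp) (by simp) (by simp) (by simp) (by simp) (by simp)
  exact φ.domain_nontrivial

set_option maxHeartbeats 400000 in
/-- **The annihilator of `f = ι(a₀₁a₁₂a₂₀)` lies in every prime of a chart presentation.** For a
prime `𝔮` of `T` and `s f = 0`: let `K = Frac(T ⧸ 𝔮)` and `ȳ, ū, z̄, v̄` the images of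
`a₀₁, a₂₀, a₁₁, a₂₂` (non-zero: their product is the unit `g₀`), `x̄ = w̄ = 0` (from `x²zv = 0`,
`w²yu = 0`). The tangent vector `𝔽_p[A] → K[ε]`, `a₀₀ ↦ ȳū ε`, `a₁₂ ↦ -z̄v̄ ε`,
`a₀₁, a₁₁, a₂₀, a₂₂ ↦ ȳ, z̄, ū, v̄`, other entries `↦ 0`, kills the five relations and makes `g₀` a
unit, so it factors through `T` (`hlift`), over the reduction `T → K` (`hext`); applying it to
`s f = 0` and reading the `ε`-coefficient gives `s̄ · (-ȳz̄v̄ū) = 0`, so `s ∈ 𝔮`. [folklore] -/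
theorem mem_of_mul_ywu_eq_zero
    (h1 : ι (X (0,0) * X (1,1) * X (2,2) - X (0,0) * X (1,2) * X (2,1)
        - X (0,1) * X (1,0) * X (2,2) + X (0,1) * X (1,2) * X (2,0)
        + X (0,2) * X (1,0) * X (2,1) - X (0,2) * X (1,1) * X (2,0)) = 0)
    (h2 : ι (X (0,0) * X (1,2) - X (0,2) * X (1,0)) = 0)
    (h3 : ι (X (0,2)) = 0) (h4 : ι (X (1,0)) = 0) (h5 : ι (X (2,1)) = 0)
    (hunit : IsUnit (ι (X (0,1) * X (2,0) * X (1,1) * X (2,2))))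
    (hlift : ∀ (D : Type) [CommRing D] (ψ : MvPolynomial (Fin 3 × Fin 3) (ZMod p) →+* D),
      ψ (X (0,0) * X (1,1) * X (2,2) - X (0,0) * X (1,2) * X (2,1)
        - X (0,1) * X (1,0) * X (2,2) + X (0,1) * X (1,2) * X (2,0)
        + X (0,2) * X (1,0) * X (2,1) - X (0,2) * X (1,1) * X (2,0)) = 0 →
      ψ (X (0,0) * X (1,2) - X (0,2) * X (1,0)) = 0 →
      ψ (X (0,2)) = 0 → ψ (X (1,0)) = 0 → ψ (X (2,1)) = 0 →
      IsUnit (ψ (X (0,1) * X (2,0) * X (1,1) * X (2,2))) →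
      ∃ φ : T →+* D, ∀ a, φ (ι a) = ψ a)
    (hext : ∀ (D : Type) [CommRing D] (φ₁ φ₂ : T →+* D), (∀ a, φ₁ (ι a) = φ₂ (ι a)) → φ₁ = φ₂)
    (q : PrimeSpectrum T) (s : T) (hs : s * ι (X (0,1) * X (1,2) * X (2,0)) = 0) :
    s ∈ q.asIdeal := by
  classical
  haveI : q.asIdeal.IsPrime := q.isPrime
  haveI : IsDomain (T ⧸ q.asIdeal) := Ideal.Quotient.isDomain q.asIdeal
  -- the five relations among the images `ι(a_ij)`
  have r1 : ι (X (0,0)) * ι (X (1,1)) * ι (X (2,2)) - ι (X (0,0)) * ι (X (1,2)) * ι (X (2,1))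
      - ι (X (0,1)) * ι (X (1,0)) * ι (X (2,2)) + ι (X (0,1)) * ι (X (1,2)) * ι (X (2,0))
      + ι (X (0,2)) * ι (X (1,0)) * ι (X (2,1)) - ι (X (0,2)) * ι (X (1,1)) * ι (X (2,0)) = 0 := by
    simpa only [map_sub, map_add, map_mul] using h1
  have r2 : ι (X (0,0)) * ι (X (1,2)) - ι (X (0,2)) * ι (X (1,0)) = 0 := by
    simpa only [map_sub, map_mul] using h2
  -- the reduction `π : T → K = Frac (T ⧸ 𝔮)`
  let K : Type := FractionRing (T ⧸ q.asIdeal)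
  let π : T →+* K := (algebraMap (T ⧸ q.asIdeal) K).comp (Ideal.Quotient.mk q.asIdeal)
  have hπmem : ∀ t : T, π t = 0 → t ∈ q.asIdeal := by
    intro t ht
    have h' : algebraMap (T ⧸ q.asIdeal) K (Ideal.Quotient.mk q.asIdeal t) =
        algebraMap (T ⧸ q.asIdeal) K 0 := by rw [map_zero]; exact ht
    exact Ideal.Quotient.eq_zero_iff_mem.mp (IsFractionRing.injective (T ⧸ q.asIdeal) K h')
  have hπof : ∀ t : T, t ∈ q.asIdeal → π t = 0 := by
    intro t ht
    show algebraMap (T ⧸ q.asIdeal) K (Ideal.Quotient.mk q.asIdeal t) = 0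
    rw [Ideal.Quotient.eq_zero_iff_mem.mpr ht, map_zero]
  let yb : K := π (ι (X (0,1)))
  let ub : K := π (ι (X (2,0)))
  let zb : K := π (ι (X (1,1)))
  let vb : K := π (ι (X (2,2)))
  -- (a) the four factors of `g₀` are non-zero in `K`
  have hgK : yb * ub * zb * vb ≠ 0 := by
    have h := (hunit.map π).ne_zero
    simpa only [map_mul] using h
  have hy : yb ≠ 0 := fun h => hgK (by rw [h]; ring)
  have hu : ub ≠ 0 := fun h => hgK (by rw [h]; ring)
  have hz : zb ≠ 0 := fun h => hgK (by rw [h]; ring)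
  have hv : vb ≠ 0 := fun h => hgK (by rw [h]; ring)
  -- (b) `x̄ = w̄ = 0`
  have hx : π (ι (X (0,0))) = 0 := by
    have h0 : π (ι (X (0,0))) ^ 2 * zb * vb = 0 := by
      have h := congrArg π (x_sq_zv_eq_zero _ _ _ _ _ _ _ _ _ r1 r2 h3 h4 h5)
      simpa only [map_mul, map_pow, map_zero] using h
    rcases mul_eq_zero.mp h0 with k1 | k1
    · rcases mul_eq_zero.mp k1 with k2 | k2
      · exact pow_eq_zero_iff two_ne_zero |>.mp k2
      · exact absurd k2 hz
    · exact absurd k1 hv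
  have hw : π (ι (X (1,2))) = 0 := by
    have h0 : π (ι (X (1,2))) ^ 2 * yb * ub = 0 := by
      have h := congrArg π (w_sq_yu_eq_zero _ _ _ _ _ _ _ _ _ r1 r2 h3 h4 h5)
      simpa only [map_mul, map_pow, map_zero] using h
    rcases mul_eq_zero.mp h0 with k1 | k1
    · rcases mul_eq_zero.mp k1 with k2 | k2
      · exact pow_eq_zero_iff two_ne_zero |>.mp k2
      · exact absurd k2 hy
    · exact absurd k1 hu
  -- (c) the tangent vector `𝔽_p[A] → K[ε]`
  let val : Fin 3 × Fin 3 → TrivSqZeroExt K K := fun ij =>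
    (![![TrivSqZeroExt.inr (yb * ub), TrivSqZeroExt.inl yb, 0],
       ![0, TrivSqZeroExt.inl zb, TrivSqZeroExt.inr (-(zb * vb))],
       ![TrivSqZeroExt.inl ub, 0, TrivSqZeroExt.inl vb]] :
        Fin 3 → Fin 3 → TrivSqZeroExt K K) ij.1 ij.2
  let θ : ZMod p →+* TrivSqZeroExt K K := (algebraMap K _).comp (π.comp (ι.comp MvPolynomial.C))
  let ψ : MvPolynomial (Fin 3 × Fin 3) (ZMod p) →+* TrivSqZeroExt K K := MvPolynomial.eval₂Hom θ val
  have hψX : ∀ ij, ψ (X ij) = val ij := fun ij => MvPolynomial.eval₂Hom_X' θ val ij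
  have k3 : ψ (X (0,2)) = 0 := by rw [hψX]; simp [val]
  have k4 : ψ (X (1,0)) = 0 := by rw [hψX]; simp [val]
  have k5 : ψ (X (2,1)) = 0 := by rw [hψX]; simp [val]
  have k2 : ψ (X (0,0) * X (1,2) - X (0,2) * X (1,0)) = 0 := by
    simp only [map_sub, map_mul, hψX]
    simp [val]
  have k1 : ψ (X (0,0) * X (1,1) * X (2,2) - X (0,0) * X (1,2) * X (2,1)
        - X (0,1) * X (1,0) * X (2,2) + X (0,1) * X (1,2) * X (2,0)
        + X (0,2) * X (1,0) * X (2,1) - X (0,2) * X (1,1) * X (2,0)) = 0 := by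
    simp only [map_sub, map_add, map_mul, hψX]
    simp only [val, Matrix.cons_val_zero, Matrix.cons_val_one, Matrix.head_cons,
      Matrix.cons_val_two, Matrix.tail_cons]
    ext <;> simp [TrivSqZeroExt.fst_mul, TrivSqZeroExt.snd_mul]
    ring
  have k6 : IsUnit (ψ (X (0,1) * X (2,0) * X (1,1) * X (2,2))) := by
    simp only [map_mul, hψX]
    simp only [val, Matrix.cons_val_zero, Matrix.cons_val_one, Matrix.head_cons,
      Matrix.cons_val_two, Matrix.tail_cons]
    rw [← TrivSqZeroExt.inl_mul, ← TrivSqZeroExt.inl_mul, ← TrivSqZeroExt.inl_mul,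
      TrivSqZeroExt.isUnit_inl_iff]
    exact isUnit_iff_ne_zero.mpr hgK
  obtain ⟨φ, hφι⟩ := hlift _ ψ k1 k2 k3 k4 k5 k6
  -- (d) the tangent vector lies over `π : T → K`
  have hfst : ∀ t : T, (φ t).fst = π t := by
    suffices h : (TrivSqZeroExt.fstHom K K K).toRingHom.comp φ = π from
      fun t => RingHom.congr_fun h t
    apply hext
    intro a
    show (φ (ι a)).fst = π (ι a)
    rw [hφι]
    revert a
    suffices h : (TrivSqZeroExt.fstHom K K K).toRingHom.comp ψ = π.comp ι from
      fun a => RingHom.congr_fun h a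
    apply MvPolynomial.ringHom_ext
    · intro c
      show (ψ (MvPolynomial.C c)).fst = π (ι (MvPolynomial.C c))
      rw [MvPolynomial.eval₂Hom_C]
      simp [θ, TrivSqZeroExt.algebraMap_eq_inl]
    · intro ij
      show (ψ (X ij)).fst = π (ι (X ij))
      rw [hψX]
      rcases ij with ⟨i, j⟩
      fin_cases i <;> fin_cases j <;> simp [val, hx, hw, h3, h4, h5] <;> rfl
  -- (e) apply the tangent vector to `s * f = 0` and read off the `ε`-coefficient
  have hφf : φ (ι (X (0,1) * X (1,2) * X (2,0))) = TrivSqZeroExt.inr (-(yb * (zb * vb) * ub)) := by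
    rw [hφι]
    simp only [map_mul, hψX]
    simp only [val, Matrix.cons_val_zero, Matrix.cons_val_one, Matrix.head_cons,
      Matrix.cons_val_two, Matrix.tail_cons]
    ext <;> simp [TrivSqZeroExt.fst_mul, TrivSqZeroExt.snd_mul]
    ring
  have hsf : (φ s * φ (ι (X (0,1) * X (1,2) * X (2,0)))).snd = 0 := by
    have h := congrArg (fun t => (φ t).snd) hs
    simpa only [map_mul φ s, map_zero, TrivSqZeroExt.snd_zero] using h
  rw [hφf, TrivSqZeroExt.snd_mul, hfst s] at hsf
  simp only [TrivSqZeroExt.snd_inr, TrivSqZeroExt.fst_inr, MulOpposite.op_zero, zero_smul,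
    add_zero, smul_eq_mul] at hsf
  have hc : (-(yb * (zb * vb) * ub) : K) ≠ 0 := by
    rw [neg_ne_zero]
    exact mul_ne_zero (mul_ne_zero hy (mul_ne_zero hz hv)) hu
  exact hπmem s ((mul_eq_zero.mp hsf).resolve_right hc)

end Chart

end Summit.ResolutionOfSingularities.ResolutionOfSingularities.Theorems.MatroidCellRes.Negative

end
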